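import Mathlib
import Literature.Combinatorics.Optimization.TracialDesigns
import Summits.PneNP.PneNP.Theorems.ChebyshevTracialDesignLevelMarginals
import Summits.PneNP.PneNP.Theorems.ChebyshevTracialDesignProfileInterpolation
import Summits.PneNP.PneNP.Theorems.ChebyshevTracialDesignSaturatedSubsets

/-!
# Cell pnp-psdrank, route `ChebyshevTracialDesign`: the PARITY KERNELS `F_σ(U,M) = (Σ_{e ∈ M ∩ δ(U)} σ_e)² − 1` — nonnegative,
# vanishing on the tight pairs, and of value EXACTLY `1` under every exact design of degree `≥ 2`, for every sign pattern `σ`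
# (crux `TracialDecayExp20`, stmt-PneNP-19878; eng g12, MEMO-12 §4(b))

For a sign pattern `σ : Sym2 (Fin n) → {±1}` let `G_σ(U,M) := Σ_{e ∈ M, e crosses U} σ_e` (a signed version of Rothvoß's crossing number
`cc(U,M) = |δ(U) ∩ M|` [cite: Rothvoss2017, §2 (PDF pp. 5–6)]) and `F_σ := G_σ² − 1`. Proved here:
* `crossSum_sq_eq_one_of_tight` — on a tight pair (`cc = 1`) `G_σ = ±1`, so `F_σ = 0`;
* `one_le_crossSum_sq` — `G_σ` is a sum of an odd number of signs (`cc(U,M)` is odd for an odd cut), so `G_σ² ≥ 1`: `F_σ ≥ 0`;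
* `sum_Qset_crossSum_sq` — the EXACT level profile: `Σ_{(U,M) ∈ Q_c(t)} G_σ(U,M)² = |Q_c(t)|·(c + c(c−1)·m₂(σ))` with
  `m₂(σ)` the mean of `σ_e σ_{e'}` over ordered pairs of vertex-disjoint pairs (`𝔖_n` is transitive on such pairs and preserves the
  level classes, `ChebyshevTracialDesignLevelMarginals.cc_perm`);
* `design_value_parityKernel` — hence for EVERY exact extrapolation design of degree `≥ 2` [cite: CoppersmithRivlin1992, Thm. (p. 970)]
  and every `σ`: `Σ_{U,M} W(U,M)·F_σ(U,M) = Σ_c w_c (c−1)(1 + c·m₂) = 1` — the same pairing as the slack matrix `cc − 1` itself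
  (the slack matrix is the average of the `F_σ` over all `2^{C(n,2)}` sign patterns).
Consequence (by the route's assembly, `TracialHyperplaneBoundAt` being stated for every nonnegative kernel vanishing on the tight pairs):
the crux `TracialDecayExp20` implies a stretched-exponential lower bound on the psd rank of EVERY `F_σ` — a family of explicit refuter targets
with no design or tightness bookkeeping (MEMO-12 §4(b)). Per column `M`, `F_σ(·,M)` is Grigoriev's knapsack/parity polynomial
`(|z| − m)² − 1` on a parity class, up to a cube automorphism.
Stature: support/instrument. WHAT THIS IS NOT: no statement about the psd rank of any `F_σ`; nothing on psd rank of `P_PM(K_n)`; no P-vs-NP content.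
-/

set_option linter.dupNamespace false -- `Summit.PneNP.PneNP.…`: summit = sub-problem (D-0017)

noncomputable section

namespace Summit.PneNP.PneNP.Theorems.ChebyshevTracialDesignParityKernel

open Finset Literature.Barriers.PneNP Literature.Combinatorics.SimpleGraph.CycleSpace Literature.Combinatorics.Optimization
open Summit.PneNP.PneNP.Theorems.ChebyshevTracialDesignLevelMarginals

variable {n : ℕ}

/-! ### §1 The signed crossing sum on tight pairs and its parity -/

/-- On a tight pair the signed crossing sum is the sign of the unique crossing edge, so its square is `1`. -/
theorem crossSum_sq_eq_one_of_tight (σ : Sym2 (Fin n) → ℝ) (hσ : ∀ e, σ e = 1 ∨ σ e = -1)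
    (U : OddSet n) (M : PMatch n) (h : cc U M = 1) :
    (∑ e ∈ M.1.filter (Crosses U.1), σ e) ^ 2 = 1 := by
  obtain ⟨e₀, he₀⟩ := card_eq_one.1 h
  change M.1.filter (Crosses U.1) = {e₀} at he₀
  rw [he₀, sum_singleton]
  rcases hσ e₀ with h1 | h1 <;> rw [h1] <;> norm_num

/-- The crossing number of an odd cut is odd. -/
theorem odd_cc (U : OddSet n) (M : PMatch n) : Odd (cc U M) := by
  have h := ChebyshevTracialDesignSaturatedSubsets.card_eq_cc_add U M
  obtain ⟨k, hk⟩ := U.2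
  rw [hk] at h
  exact ⟨k - (U.1.filter fun x => x < M.2.partner x ∧ M.2.partner x ∈ U.1).card, by omega⟩

/-- A sum of an odd number of signs is an odd integer: `Σ_{e ∈ s} σ_e = 2j + 1` for some integer `j`. -/
theorem sum_signs_eq_two_mul_add_one (σ : Sym2 (Fin n) → ℝ) (hσ : ∀ e, σ e = 1 ∨ σ e = -1)
    (s : Finset (Sym2 (Fin n))) (hs : Odd s.card) : ∃ j : ℤ, ∑ e ∈ s, σ e = 2 * j + 1 := by
  -- `σ_e = 1 − 2·[σ_e = −1]`
  have hpt : ∀ e, σ e = 1 - 2 * (if σ e = -1 then 1 else 0) := by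
    intro e; rcases hσ e with h | h <;> norm_num [h]
  have hsum : ∑ e ∈ s, σ e = s.card - 2 * ((s.filter fun e => σ e = -1).card : ℝ) := by
    rw [sum_congr rfl fun e _ => hpt e, sum_sub_distrib, sum_const, nsmul_eq_mul, mul_one, ← mul_sum]
    congr 1
    rw [← sum_filter, sum_const, nsmul_eq_mul, mul_one]
  obtain ⟨k, hk⟩ := hs
  refine ⟨(k : ℤ) - ((s.filter fun e => σ e = -1).card : ℤ), ?_⟩
  rw [hsum, hk]; push_cast; ring

/-- **`F_σ ≥ 0`**: the square of the signed crossing sum of an odd cut is at least `1`. -/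
theorem one_le_crossSum_sq (σ : Sym2 (Fin n) → ℝ) (hσ : ∀ e, σ e = 1 ∨ σ e = -1) (U : OddSet n) (M : PMatch n) :
    1 ≤ (∑ e ∈ M.1.filter (Crosses U.1), σ e) ^ 2 := by
  obtain ⟨j, hj⟩ := sum_signs_eq_two_mul_add_one σ hσ (M.1.filter (Crosses U.1)) (odd_cc U M)
  rw [hj]
  have hjj : (0 : ℝ) ≤ (j : ℝ) * ((j : ℝ) + 1) := by
    rcases le_or_gt 0 j with h0 | h0
    · have : (0 : ℝ) ≤ j := by exact_mod_cast h0
      positivity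
    · have h1 : j + 1 ≤ 0 := by omega
      have : (j : ℝ) + 1 ≤ 0 := by exact_mod_cast h1
      have : (j : ℝ) ≤ 0 := by linarith
      nlinarith
  nlinarith

/-! ### §2 Expanding the square: diagonal `= cc`, off-diagonal `= Σ` over ordered pairs of distinct crossing edges -/

/-- `G_σ(U,M)² = cc(U,M) + Σ_{(e,e') ∈ offDiag(crossing edges)} σ_e σ_{e'}`. -/
theorem crossSum_sq_eq (σ : Sym2 (Fin n) → ℝ) (hσ : ∀ e, σ e = 1 ∨ σ e = -1) (U : OddSet n) (M : PMatch n) :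
    (∑ e ∈ M.1.filter (Crosses U.1), σ e) ^ 2 =
      (cc U M : ℝ) + ∑ p ∈ (M.1.filter (Crosses U.1)).offDiag, σ p.1 * σ p.2 := by
  set s := M.1.filter (Crosses U.1) with hs
  have hsq : ∀ e, σ e * σ e = 1 := by intro e; rcases hσ e with h | h <;> rw [h] <;> norm_num
  rw [sq, sum_mul_sum, ← sum_product', ← diag_union_offDiag, sum_union (disjoint_diag_offDiag _),
    sum_diag]
  congr 1
  rw [sum_congr rfl fun e _ => hsq e, sum_const, nsmul_eq_mul, mul_one]
  rfl

/-! ### §3 Double counting and the transitivity of `𝔖_n` on ordered pairs of disjoint pairs -/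

/-- Generic double count: `Σ_{q ∈ A} Σ_{p ∈ E(q)} f(p) = Σ_p f(p) · #{q ∈ A : p ∈ E(q)}`. -/
theorem sum_sum_eq_sum_mul_card {α β : Type*} [Fintype β] [DecidableEq β] (A : Finset α) (E : α → Finset β)
    (f : β → ℝ) :
    ∑ q ∈ A, ∑ p ∈ E q, f p = ∑ p, f p * ((A.filter fun q => p ∈ E q).card : ℝ) := by
  classical
  calc ∑ q ∈ A, ∑ p ∈ E q, f p = ∑ q ∈ A, ∑ p, if p ∈ E q then f p else 0 := by
        refine sum_congr rfl fun q _ => ?_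
        rw [← sum_filter]; congr 1; ext p; simp
    _ = ∑ p, ∑ q ∈ A, if p ∈ E q then f p else 0 := sum_comm
    _ = ∑ p, f p * ((A.filter fun q => p ∈ E q).card : ℝ) := by
        refine sum_congr rfl fun p _ => ?_
        rw [← sum_filter, sum_const, nsmul_eq_mul, mul_comm]

/-- Two distinct edges of a perfect matching are non-diagonal and vertex-disjoint. -/
theorem edges_disjoint (M : PMatch n) {e e' : Sym2 (Fin n)} (he : e ∈ M.1) (he' : e' ∈ M.1) (hne : e ≠ e') :
    ¬ e.IsDiag ∧ ¬ e'.IsDiag ∧ ∀ x, x ∈ e → x ∈ e' → False :=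
  ⟨M.2.not_isDiag he, M.2.not_isDiag he', fun _ hx hx' => hne (M.2.unique he he' hx hx')⟩

/-- `𝔖_n` is transitive on ordered quadruples of distinct points. -/
theorem exists_perm_quad {a b c d a' b' c' d' : Fin n}
    (hab : a ≠ b) (hac : a ≠ c) (had : a ≠ d) (hbc : b ≠ c) (hbd : b ≠ d) (hcd : c ≠ d)
    (hab' : a' ≠ b') (hac' : a' ≠ c') (had' : a' ≠ d') (hbc' : b' ≠ c') (hbd' : b' ≠ d') (hcd' : c' ≠ d') :
    ∃ π : Equiv.Perm (Fin n), π a = a' ∧ π b = b' ∧ π c = c' ∧ π d = d' := by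
  classical
  set f : Fin n → Fin n := fun x => if x = a then a' else if x = b then b' else if x = c then c' else d' with hf
  have hfa : f a = a' := by simp [hf]
  have hfb : f b = b' := by simp [hf, hab.symm]
  have hfc : f c = c' := by simp [hf, hac.symm, hbc.symm]
  have hfd : f d = d' := by simp [hf, had.symm, hbd.symm, hcd.symm]
  -- a left inverse of `f` on `{a,b,c,d}`
  set fi : Fin n → Fin n := fun y => if y = a' then a else if y = b' then b else if y = c' then c else d with hfi
  have hia : fi a' = a := by simp [hfi]
  have hib : fi b' = b := by simp [hfi, hab'.symm]
  have hic : fi c' = c := by simp [hfi, hac'.symm, hbc'.symm]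
  have hid : fi d' = d := by simp [hfi, had'.symm, hbd'.symm, hcd'.symm]
  have hleft : ∀ x ∈ ({a, b, c, d} : Finset (Fin n)), fi (f x) = x := by
    intro x hx
    simp only [mem_insert, mem_singleton] at hx
    rcases hx with rfl | rfl | rfl | rfl
    · rw [hfa, hia]
    · rw [hfb, hib]
    · rw [hfc, hic]
    · rw [hfd, hid]
  have hinj : Set.InjOn f ↑({a, b, c, d} : Finset (Fin n)) := by
    intro x hx y hy hxy
    have h1 := hleft x (by exact_mod_cast hx)
    have h2 := hleft y (by exact_mod_cast hy)
    rw [← h1, ← h2, hxy]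
  obtain ⟨g, hg⟩ := Finset.exists_equiv_extend_of_card_eq (α := Fin n) (t := (univ : Finset (Fin n)))
    (by rw [card_univ]) (s := {a, b, c, d}) (f := f) (by intro x _; exact mem_univ _) hinj
  refine ⟨g.trans (Equiv.subtypeUnivEquiv (fun x => mem_univ x)), ?_, ?_, ?_, ?_⟩
  · have := hg a (by simp); simp only [Equiv.trans_apply, Equiv.subtypeUnivEquiv_apply]; rw [this, hfa]
  · have := hg b (by simp); simp only [Equiv.trans_apply, Equiv.subtypeUnivEquiv_apply]; rw [this, hfb]
  · have := hg c (by simp); simp only [Equiv.trans_apply, Equiv.subtypeUnivEquiv_apply]; rw [this, hfc]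
  · have := hg d (by simp); simp only [Equiv.trans_apply, Equiv.subtypeUnivEquiv_apply]; rw [this, hfd]

/-- `𝔖_n` is transitive on ordered pairs of vertex-disjoint non-diagonal pairs. -/
theorem exists_perm_map_pair {e e' f f' : Sym2 (Fin n)}
    (he : ¬ e.IsDiag) (he' : ¬ e'.IsDiag) (hd : ∀ x, x ∈ e → x ∈ e' → False)
    (hf : ¬ f.IsDiag) (hf' : ¬ f'.IsDiag) (hd' : ∀ x, x ∈ f → x ∈ f' → False) :
    ∃ π : Equiv.Perm (Fin n), Sym2.map π e = f ∧ Sym2.map π e' = f' := by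
  induction e using Sym2.ind with
  | h a b =>
  induction e' using Sym2.ind with
  | h c d =>
  induction f using Sym2.ind with
  | h a' b' =>
  induction f' using Sym2.ind with
  | h c' d' =>
    rw [Sym2.mk_isDiag_iff] at he he' hf hf'
    have hac : a ≠ c := fun h => hd a (Sym2.mem_mk_left a b) (h ▸ Sym2.mem_mk_left c d)
    have had : a ≠ d := fun h => hd a (Sym2.mem_mk_left a b) (h ▸ Sym2.mem_mk_right c d)
    have hbc : b ≠ c := fun h => hd b (Sym2.mem_mk_right a b) (h ▸ Sym2.mem_mk_left c d)
    have hbd : b ≠ d := fun h => hd b (Sym2.mem_mk_right a b) (h ▸ Sym2.mem_mk_right c d)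
    have hac' : a' ≠ c' := fun h => hd' a' (Sym2.mem_mk_left a' b') (h ▸ Sym2.mem_mk_left c' d')
    have had' : a' ≠ d' := fun h => hd' a' (Sym2.mem_mk_left a' b') (h ▸ Sym2.mem_mk_right c' d')
    have hbc' : b' ≠ c' := fun h => hd' b' (Sym2.mem_mk_right a' b') (h ▸ Sym2.mem_mk_left c' d')
    have hbd' : b' ≠ d' := fun h => hd' b' (Sym2.mem_mk_right a' b') (h ▸ Sym2.mem_mk_right c' d')
    obtain ⟨π, h1, h2, h3, h4⟩ := exists_perm_quad he hac had hbc hbd he' hf hac' had' hbc' hbd' hf'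
    exact ⟨π, by rw [Sym2.map_mk, h1, h2], by rw [Sym2.map_mk, h3, h4]⟩

/-- The pair count `#{(U,M) ∈ Q_c(t) : e, e' ∈ M, both crossing U}` is invariant under relabelling. -/
theorem pairCount_perm (t c : ℕ) (π : Equiv.Perm (Fin n)) (e e' : Sym2 (Fin n)) :
    ((Qset n t c).filter fun q => Sym2.map π e ∈ q.2.1 ∧ Sym2.map π e' ∈ q.2.1 ∧
        Crosses q.1.1 (Sym2.map π e) ∧ Crosses q.1.1 (Sym2.map π e')).card =
      ((Qset n t c).filter fun q => e ∈ q.2.1 ∧ e' ∈ q.2.1 ∧ Crosses q.1.1 e ∧ Crosses q.1.1 e').card := by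
  classical
  refine card_bij'
    (fun q _ => ((⟨q.1.1.image ⇑π⁻¹, odd_card_image π⁻¹ q.1⟩ : OddSet n), π⁻¹ • q.2))
    (fun q _ => ((⟨q.1.1.image π, odd_card_image π q.1⟩ : OddSet n), π • q.2)) ?_ ?_ ?_ ?_
  · rintro ⟨U, M⟩ hq
    simp only [mem_filter, mem_Qset_iff] at hq ⊢
    obtain ⟨⟨hUt, hcc⟩, h1, h2, h3, h4⟩ := hq
    have hcc' : cc ⟨U.1.image ⇑π⁻¹, odd_card_image π⁻¹ U⟩ (π⁻¹ • M) = c := by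
      have h := cc_perm π⁻¹ U M; rw [h]; exact hcc
    refine ⟨⟨by rw [card_image_of_injective _ (Equiv.injective _)]; exact hUt, hcc'⟩, ?_, ?_, ?_, ?_⟩
    · rw [PMSol.smul_val, mem_image]; exact ⟨_, h1, sym2_map_inv_map π e⟩
    · rw [PMSol.smul_val, mem_image]; exact ⟨_, h2, sym2_map_inv_map π e'⟩
    · have := (crosses_image_map_iff π⁻¹ U.1 (Sym2.map π e)).2 h3; rwa [sym2_map_inv_map] at this
    · have := (crosses_image_map_iff π⁻¹ U.1 (Sym2.map π e')).2 h4; rwa [sym2_map_inv_map] at this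
  · rintro ⟨U, M⟩ hq
    simp only [mem_filter, mem_Qset_iff] at hq ⊢
    obtain ⟨⟨hUt, hcc⟩, h1, h2, h3, h4⟩ := hq
    refine ⟨⟨by rw [card_image_of_injective _ (Equiv.injective _)]; exact hUt, by rw [cc_perm]; exact hcc⟩,
      ?_, ?_, ?_, ?_⟩
    · rw [PMSol.smul_val]; exact mem_image_of_mem _ h1
    · rw [PMSol.smul_val]; exact mem_image_of_mem _ h2
    · exact (crosses_image_map_iff π U.1 e).2 h3
    · exact (crosses_image_map_iff π U.1 e').2 h4
  · rintro ⟨U, M⟩ _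
    simp only [Prod.mk.injEq]
    exact ⟨image_image_inv_oddSet π U, smul_inv_smul π M⟩
  · rintro ⟨U, M⟩ _
    simp only [Prod.mk.injEq]
    exact ⟨image_inv_image_oddSet π U, inv_smul_smul π M⟩

/-! ### §4 The exact level profile of `G_σ²` -/

/-- For a pair of crossing edges data: membership in `offDiag` of the crossing edges, unfolded. -/
theorem mem_offDiag_crossing_iff (U : OddSet n) (M : PMatch n) (p : Sym2 (Fin n) × Sym2 (Fin n)) :
    p ∈ (M.1.filter (Crosses U.1)).offDiag ↔
      (p.1 ∈ M.1 ∧ p.2 ∈ M.1 ∧ Crosses U.1 p.1 ∧ Crosses U.1 p.2) ∧ p.1 ≠ p.2 := by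
  rw [mem_offDiag, mem_filter, mem_filter]; tauto

/-- **Off-diagonal level sums factor through the disjoint-pair average.** There is a constant `N₀` (the common pair count) with
`Σ_{(U,M) ∈ Q_c(t)} Σ_{(e,e') ∈ offDiag(crossing edges)} f(e,e') = N₀ · Σ_{(e,e') disjoint non-diagonal} f(e,e')` for every `f`. -/
theorem exists_pairCount (t c : ℕ) : ∃ N₀ : ℝ, ∀ f : Sym2 (Fin n) × Sym2 (Fin n) → ℝ,
    ∑ q ∈ Qset n t c, ∑ p ∈ (q.2.1.filter (Crosses q.1.1)).offDiag, f p =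
      N₀ * ∑ p ∈ (univ.filter fun p : Sym2 (Fin n) × Sym2 (Fin n) =>
              ¬ p.1.IsDiag ∧ ¬ p.2.IsDiag ∧ ∀ x, x ∈ p.1 → x ∈ p.2 → False), f p := by
  classical
  set T := (univ.filter fun p : Sym2 (Fin n) × Sym2 (Fin n) =>
      ¬ p.1.IsDiag ∧ ¬ p.2.IsDiag ∧ ∀ x, x ∈ p.1 → x ∈ p.2 → False) with hT
  -- the pair count in its four-conjunct form
  set N : Sym2 (Fin n) × Sym2 (Fin n) → ℝ := fun p =>
    (((Qset n t c).filter fun q => p.1 ∈ q.2.1 ∧ p.2 ∈ q.2.1 ∧ Crosses q.1.1 p.1 ∧ Crosses q.1.1 p.2).card : ℝ)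
    with hN
  -- off T the offDiag-membership count vanishes; on T it equals N p
  have hcount : ∀ p, (((Qset n t c).filter fun q => p ∈ (q.2.1.filter (Crosses q.1.1)).offDiag).card : ℝ) =
      if p ∈ T then N p else 0 := by
    intro p
    split_ifs with hp
    · simp only [hN]
      congr 2
      refine filter_congr fun q _ => ?_
      rw [mem_offDiag_crossing_iff]
      have hne : p.1 ≠ p.2 := by
        simp only [hT, mem_filter, mem_univ, true_and] at hp
        intro h
        induction hp1 : p.1 using Sym2.ind with
        | h x y =>
          have : x ∈ p.1 := by rw [hp1]; exact Sym2.mem_mk_left x y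
          exact hp.2.2 x this (h ▸ this)
      tauto
    · norm_cast
      rw [card_eq_zero, filter_eq_empty_iff]
      intro q _ hq
      rw [mem_offDiag_crossing_iff] at hq
      apply hp
      simp only [hT, mem_filter, mem_univ, true_and]
      exact edges_disjoint q.2 hq.1.1 hq.1.2.1 hq.2
  -- N is constant on T
  have hconst : ∀ p ∈ T, ∀ p' ∈ T, N p = N p' := by
    intro p hp p' hp'
    simp only [hT, mem_filter, mem_univ, true_and] at hp hp'
    obtain ⟨π, h1, h2⟩ := exists_perm_map_pair hp'.1 hp'.2.1 hp'.2.2 hp.1 hp.2.1 hp.2.2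
    simp only [hN]
    rw [← h1, ← h2, pairCount_perm]
  by_cases hTe : T = ∅
  · refine ⟨0, fun f => ?_⟩
    rw [hTe, sum_empty, mul_zero, sum_sum_eq_sum_mul_card]
    refine sum_eq_zero fun p _ => ?_
    rw [hcount p, hTe]; simp
  · obtain ⟨p₀, hp₀⟩ := nonempty_iff_ne_empty.2 hTe
    refine ⟨N p₀, fun f => ?_⟩
    rw [sum_sum_eq_sum_mul_card]
    calc ∑ p, f p * (((Qset n t c).filter fun q => p ∈ (q.2.1.filter (Crosses q.1.1)).offDiag).card : ℝ)
        = ∑ p, (if p ∈ T then f p * N p₀ else 0) := by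
          refine sum_congr rfl fun p _ => ?_
          rw [hcount p]
          split_ifs with hp
          · rw [hconst p hp p₀ hp₀]
          · rw [mul_zero]
      _ = ∑ p ∈ T, f p * N p₀ := by rw [sum_ite_mem, univ_inter]
      _ = N p₀ * ∑ p ∈ T, f p := by rw [mul_sum]; exact sum_congr rfl fun p _ => mul_comm _ _

/-- The number of ordered pairs of distinct crossing edges of a pair at level `c` is `c(c−1)`. -/
theorem card_offDiag_crossing {t c : ℕ} {q : OddSet n × PMatch n} (hq : q ∈ Qset n t c) :
    (((q.2.1.filter (Crosses q.1.1)).offDiag).card : ℝ) = (c : ℝ) * ((c : ℝ) - 1) := by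
  rw [offDiag_card]
  have hc : (q.2.1.filter (Crosses q.1.1)).card = c := (mem_Qset_iff.1 hq).2
  rw [hc]
  have : c ≤ c * c := Nat.le_mul_self c
  push_cast [Nat.cast_sub this]
  ring

/-- **The exact level profile of `G_σ²`**: `Σ_{(U,M) ∈ Q_c(t)} G_σ(U,M)² = |Q_c(t)| · (c + c(c−1)·m₂(σ))`, where `m₂(σ)` is the mean of
`σ_e σ_{e'}` over ordered pairs of vertex-disjoint non-diagonal pairs. -/
theorem sum_Qset_crossSum_sq (σ : Sym2 (Fin n) → ℝ) (hσ : ∀ e, σ e = 1 ∨ σ e = -1) (t c : ℕ) :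
    ∑ q ∈ Qset n t c, (∑ e ∈ q.2.1.filter (Crosses q.1.1), σ e) ^ 2 =
      ((Qset n t c).card : ℝ) * ((c : ℝ) + (c : ℝ) * ((c : ℝ) - 1) *
        ((∑ p ∈ (univ.filter fun p : Sym2 (Fin n) × Sym2 (Fin n) =>
              ¬ p.1.IsDiag ∧ ¬ p.2.IsDiag ∧ ∀ x, x ∈ p.1 → x ∈ p.2 → False), σ p.1 * σ p.2) /
          ((univ.filter fun p : Sym2 (Fin n) × Sym2 (Fin n) =>
              ¬ p.1.IsDiag ∧ ¬ p.2.IsDiag ∧ ∀ x, x ∈ p.1 → x ∈ p.2 → False).card : ℝ))) := by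
  classical
  obtain ⟨T, hT⟩ : ∃ T : Finset (Sym2 (Fin n) × Sym2 (Fin n)), T = (univ.filter fun p : Sym2 (Fin n) × Sym2 (Fin n) =>
      ¬ p.1.IsDiag ∧ ¬ p.2.IsDiag ∧ ∀ x, x ∈ p.1 → x ∈ p.2 → False) := ⟨_, rfl⟩
  rw [← hT]
  obtain ⟨N₀, hN₀⟩ := exists_pairCount (n := n) t c
  rw [← hT] at hN₀
  -- diagonal part
  have hdiag : ∑ q ∈ Qset n t c, (∑ e ∈ q.2.1.filter (Crosses q.1.1), σ e) ^ 2 =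
      ((Qset n t c).card : ℝ) * c + ∑ q ∈ Qset n t c, ∑ p ∈ (q.2.1.filter (Crosses q.1.1)).offDiag, σ p.1 * σ p.2 := by
    rw [sum_congr rfl fun q _ => crossSum_sq_eq σ hσ q.1 q.2, sum_add_distrib]
    congr 1
    rw [sum_congr rfl fun q hq => show (cc q.1 q.2 : ℝ) = c by rw [(mem_Qset_iff.1 hq).2], sum_const, nsmul_eq_mul]
  -- counting identity: |Q_c| c (c-1) = N₀ |T|
  have hcnt : ((Qset n t c).card : ℝ) * ((c : ℝ) * ((c : ℝ) - 1)) = N₀ * (T.card : ℝ) := by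
    have h := hN₀ (fun _ => 1)
    simp only [sum_const, nsmul_eq_mul, mul_one] at h
    rw [← h, sum_congr rfl fun q hq => card_offDiag_crossing hq, sum_const, nsmul_eq_mul]
  rw [hdiag, hN₀ (fun p => σ p.1 * σ p.2)]
  by_cases hT0 : (T.card : ℝ) = 0
  · have hTe : T = ∅ := card_eq_zero.1 (by exact_mod_cast hT0)
    have hN00 : N₀ * ∑ p ∈ T, σ p.1 * σ p.2 = 0 := by rw [hTe, sum_empty, mul_zero]
    rw [hN00, hT0, div_zero, mul_zero, add_zero, add_zero]
  · have key : N₀ = ((Qset n t c).card : ℝ) * ((c : ℝ) * ((c : ℝ) - 1)) / (T.card : ℝ) := by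
      rw [hcnt, mul_div_assoc, div_self hT0, mul_one]
    rw [key]
    ring

/-! ### §5 The design value of `F_σ = G_σ² − 1` is exactly `1` -/

/-- **Every exact design of degree `≥ 2` pairs to `1` with every parity kernel**: for `W = levelWeight n t C w` with
`IsExactDesign n t T D B C w`, `2 ≤ D`, and any sign pattern `σ`,
`Σ_U Σ_M W(U,M) · ((Σ_{e ∈ M ∩ δ(U)} σ_e)² − 1) = Σ_c w_c ((c − 1) + c(c−1)·m₂(σ)) = 1 + m₂(σ)·0 = 1`
(normalisation `Σ w_c (c−1) = 1`; exactness on `X(X−1)`). [cite: Rothvoss2017, §2 (PDF p. 6, eq. (2))] -/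
theorem design_value_parityKernel {t T D : ℕ} {B : ℝ} {C : Finset ℕ} {w : ℕ → ℝ} (hD : IsExactDesign n t T D B C w)
    (h2 : 2 ≤ D) (σ : Sym2 (Fin n) → ℝ) (hσ : ∀ e, σ e = 1 ∨ σ e = -1) :
    ∑ U, ∑ M, levelWeight n t C w U M * ((∑ e ∈ M.1.filter (Crosses U.1), σ e) ^ 2 - 1) = 1 := by
  classical
  set m₂ : ℝ := (∑ p ∈ (univ.filter fun p : Sym2 (Fin n) × Sym2 (Fin n) =>
        ¬ p.1.IsDiag ∧ ¬ p.2.IsDiag ∧ ∀ x, x ∈ p.1 → x ∈ p.2 → False), σ p.1 * σ p.2) /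
      ((univ.filter fun p : Sym2 (Fin n) × Sym2 (Fin n) =>
        ¬ p.1.IsDiag ∧ ¬ p.2.IsDiag ∧ ∀ x, x ∈ p.1 → x ∈ p.2 → False).card : ℝ) with hm₂
  rw [ChebyshevTracialDesignProfileInterpolation.sum_levelWeight_mul]
  have hne := hD.2.2.2.1
  have hterm : ∀ c ∈ C, w c / ((Qset n t c).card : ℝ) *
      ∑ q ∈ Qset n t c, ((∑ e ∈ q.2.1.filter (Crosses q.1.1), σ e) ^ 2 - 1) =
      w c * (((c : ℝ) - 1) + ((c : ℝ) * ((c : ℝ) - 1)) * m₂) := by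
    intro c hc
    have hQ : ((Qset n t c).card : ℝ) ≠ 0 := by exact_mod_cast (card_pos.2 (hne c hc).2.2.2).ne'
    rw [sum_sub_distrib, sum_Qset_crossSum_sq σ hσ t c, ← hm₂, sum_const, nsmul_eq_mul, mul_one]
    field_simp
    ring
  rw [sum_congr rfl hterm]
  have hsplit : ∑ c ∈ C, w c * (((c : ℝ) - 1) + ((c : ℝ) * ((c : ℝ) - 1)) * m₂) =
      ∑ c ∈ C, w c * ((c : ℝ) - 1) + m₂ * ∑ c ∈ C, w c * ((c : ℝ) * ((c : ℝ) - 1)) := by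
    rw [mul_sum, ← sum_add_distrib]
    exact sum_congr rfl fun c _ => by ring
  -- exactness on `X (X − 1)`: `Σ w_c c(c−1) = 0`
  have hquad : ∑ c ∈ C, w c * ((c : ℝ) * ((c : ℝ) - 1)) = 0 := by
    have hp := hD.2.2.2.2.2.1 (Polynomial.X * (Polynomial.X - Polynomial.C 1)) (by
      calc (Polynomial.X * (Polynomial.X - Polynomial.C (1:ℝ))).natDegree
          ≤ Polynomial.natDegree (Polynomial.X : Polynomial ℝ) + (Polynomial.X - Polynomial.C (1:ℝ)).natDegree :=
            Polynomial.natDegree_mul_le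
        _ ≤ 1 + 1 := by
            gcongr
            · exact Polynomial.natDegree_X_le
            · exact (Polynomial.natDegree_X_sub_C_le (1:ℝ))
        _ ≤ D := by omega)
    simp only [Polynomial.eval_mul, Polynomial.eval_sub, Polynomial.eval_X, Polynomial.eval_C] at hp
    rw [hp]; norm_num
  rw [hsplit, hquad, hD.2.2.2.2.1, mul_zero, add_zero]

/-- **`F_σ` is a nonnegative kernel vanishing on the tight pairs, for every `σ`** (packaged). -/
theorem parityKernel_nonneg_and_tight (σ : Sym2 (Fin n) → ℝ) (hσ : ∀ e, σ e = 1 ∨ σ e = -1) (U : OddSet n) (M : PMatch n) :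
    0 ≤ (∑ e ∈ M.1.filter (Crosses U.1), σ e) ^ 2 - 1 ∧
      (cc U M = 1 → (∑ e ∈ M.1.filter (Crosses U.1), σ e) ^ 2 - 1 = 0) :=
  ⟨by linarith [one_le_crossSum_sq σ hσ U M], fun h => by rw [crossSum_sq_eq_one_of_tight σ hσ U M h]; ring⟩

end Summit.PneNP.PneNP.Theorems.ChebyshevTracialDesignParityKernel

end
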